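import Summits.QuantumFields.YangMills.Theorems.PoincareLipschitzLatticeLuckhausHKL
import Summits.QuantumFields.YangMills.Theorems.PoincareLipschitzLogCutoffLetters
import HarnessLib

/-!
# Crux `HistoryTailL` (stmt-QuantumFields-19936), K2 organ `hImproveCoreFlat`, road R1 (LINE 25 `CompactnessTransfer`, stub S2) — FILE H-4
# «THE CUBICAL-LAYER SOCKET OF B2′»: glue a unit lattice map `u` (outside `Q_{ρ−1}(z)`) to a unit lattice map `v` (on `Q_{ρ−h}(z)`) across the layer
# of thickness `h`, staying `S³`-valued, at cost `C·[Σ(‖δu‖² + ‖δv‖²) + h⁻²·Σ_{layer} ‖u − v‖²]` — Luckhaus' «layer energies + (L² mismatch)∕thickness²»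

Cell `ym3-torus` (YM ladder rung R3 = continuum SU(2) Yang–Mills on T³ — a RUNG, NOT the Clay problem: not d = 4, not infinite volume, not a mass
gap); TWIN-WIDTH helper seat `ym-ust-19936-w7` g13.  Helper `--supports stmt-QuantumFields-19936`; THEOREMS ONLY (0 `def`, 0 `sorry`, default
heartbeats).  Imports ✓H-3 `…LatticeLuckhausHKL` (★★★`exists_unit_interpolant`: arbitrary cutoff `t`) and ★w3 g14's ✓`…LogCutoffLetters`
(`exists_supIndex`, `supIndex_step`: the sup-norm shell index `N` with `y ∈ Q_k(z) ↔ N y ≤ k`, moving by at most one along a bond).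

THE ADAPTER (LEAD ★w1-19936 g9 10:09:56Z WORD (3)).  With the cutoff `t y := min 1 (max 0 ((ρ − N y)∕h))`: `t = 0` off `Q_{ρ−1}` (`N ≥ ρ`), `t = 1` on
`Q_{ρ−h}` (`N ≤ ρ − h`), `|δt| ≤ 1∕h` on every bond (clamp is 1-Lipschitz, `|δN| ≤ 1`), and `δt = 0` unless the bond's source lies in the layer
`Q_ρ ∖ Q_{ρ−h−1}`.  Feeding `t` to `exists_unit_interpolant` gives the socket the (Γ3)∕(Γ4) step of S2 `stub_latticeToContinuumLimit` calls.

WHAT IS PROVED (ns `…Theorems.PoincareLipschitzLatticeLuckhausAnnulus`).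
* §1 (private letters, folklore clamp facts shared with other summit trees) `abs_clamp_sub_clamp_le` (`|clamp a − clamp b| ≤ |a − b|`), `clamp_nonneg`,
  `clamp_le_one`, `clamp_eq_zero_of`, `clamp_eq_one_of`.
* §2 ★★★ `exists_unit_glue_annulus` — ∃ `C ≥ 0` ∀ unit `u v`, centre `z`, radii `1 ≤ h ≤ ρ` (ℕ), ∀ finite bond sets `T`: ∃ unit `w`, `w = u` off `Q_{ρ−1}(z)`,
  `w = v` on `Q_{ρ−h}(z)`, `Σ_T ‖δw‖² ≤ C·(Σ_T (‖δu‖² + ‖δv‖²) + (h⁻¹)²·Σ_{e ∈ T, e.1 ∈ Q_ρ ∖ Q_{ρ−h−1}} ‖u e.1 − v e.1‖²)` (`C` = H-3's constant).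
HONEST SCOPE.  A socket adapter for one brick of road R1; S1∕S2 of LINE 25, `hImproveCoreFlat`, K1, `MeanDeviationL`, `BlockLipschitzL`, `HistoryTailL` are
NOT proved here.  YM₃ on T³ is rung R3, not Clay; YM gap NOT proved; no summit statement is proved here.

References: S. Luckhaus, Indiana Univ. Math. J. 37 (1988) 349–367 (Lemma 1); R. Hardt, D. Kinderlehrer, F.-H. Lin, Comm. Math. Phys. 105 (1986) 547–570
[HardtKinderlehrerLin1986] (§2); L. Simon, Theorems on Regularity and Singularity of Energy Minimizing Maps (1996) §2.6.
-/

set_option autoImplicit false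

noncomputable section

open scoped BigOperators
open Finset

namespace Summit.QuantumFields.YangMills.Theorems.PoincareLipschitzLatticeLuckhausAnnulus

open Literature.MathematicalPhysics.QuantumFieldTheory.Balaban1983to89
open B4Eq19LatticeOperators (Zd box unitVec mem_box)
open Summit.QuantumFields.YangMills.Theorems.PoincareLipschitzLatticeLuckhausHKL (exists_unit_interpolant)
open Summit.QuantumFields.YangMills.Theorems.PoincareLipschitzLogCutoffLetters (exists_supIndex supIndex_step)

/-! ## §1 The clamp `a ↦ min 1 (max 0 a)` -/

/-- The clamp to `[0,1]` is 1-Lipschitz. [folklore] -/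
private theorem abs_clamp_sub_clamp_le (a b : ℝ) : |min 1 (max 0 a) - min 1 (max 0 b)| ≤ |a - b| := by
  calc |min 1 (max 0 a) - min 1 (max 0 b)| ≤ max |(1:ℝ) - 1| |max 0 a - max 0 b| := abs_min_sub_min_le_max _ _ _ _
    _ = |max 0 a - max 0 b| := by rw [sub_self, abs_zero, max_eq_right (abs_nonneg _)]
    _ ≤ max |(0:ℝ) - 0| |a - b| := abs_max_sub_max_le_max _ _ _ _
    _ = |a - b| := by rw [sub_self, abs_zero, max_eq_right (abs_nonneg _)]

/-- The clamp is nonnegative. [folklore] -/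
private theorem clamp_nonneg (a : ℝ) : 0 ≤ min 1 (max 0 a) := le_min zero_le_one (le_max_left _ _)

/-- The clamp is at most one. [folklore] -/
private theorem clamp_le_one (a : ℝ) : min 1 (max 0 a) ≤ 1 := min_le_left _ _

/-- The clamp vanishes on nonpositive arguments. [folklore] -/
private theorem clamp_eq_zero_of {a : ℝ} (h : a ≤ 0) : min 1 (max 0 a) = 0 := by
  rw [max_eq_left h, min_eq_right zero_le_one]

/-- The clamp is one on arguments `≥ 1`. [folklore] -/
private theorem clamp_eq_one_of {a : ℝ} (h : 1 ≤ a) : min 1 (max 0 a) = 1 := by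
  rw [max_eq_right (zero_le_one.trans h), min_eq_left h]

/-! ## §2 ★★★ The cubical-layer socket -/

/-- ★★★ **THE CUBICAL-LAYER SOCKET OF B2′.**  There is `C ≥ 0` such that for all unit lattice maps `u v : ℤ³ → S³ ⊂ ℝ⁴`, every centre `z`, all radii
`1 ≤ h ≤ ρ` and every finite bond set `T` there is a UNIT lattice map `w` with `w = u` off `Q_{ρ−1}(z)`, `w = v` on `Q_{ρ−h}(z)`, and
`Σ_T ‖w(y+e_μ) − w y‖² ≤ C·(Σ_T (‖δu‖² + ‖δv‖²) + (h⁻¹)²·Σ_{(y,μ) ∈ T, y ∈ Q_ρ(z) ∖ Q_{ρ−h−1}(z)} ‖u y − v y‖²)` — B2′ `exists_unit_interpolant` at the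
cutoff `t = min 1 (max 0 ((ρ − N)∕h))`, `N` the sup-norm shell index. [cite: HardtKinderlehrerLin1986, §2] -/
theorem exists_unit_glue_annulus : ∃ C : ℝ, 0 ≤ C ∧
    ∀ (u v : Zd 3 → EuclideanSpace ℝ (Fin 4)) (z : Zd 3) (ρ h : ℕ),
      (∀ y, ‖u y‖ = 1) → (∀ y, ‖v y‖ = 1) → 1 ≤ h → h ≤ ρ →
      ∀ T : Finset (Zd 3 × Fin 3),
        ∃ w : Zd 3 → EuclideanSpace ℝ (Fin 4),
          (∀ y, ‖w y‖ = 1) ∧ (∀ y, y ∉ box z ((ρ : ℤ) - 1) → w y = u y) ∧ (∀ y ∈ box z ((ρ : ℤ) - h), w y = v y) ∧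
          ∑ e ∈ T, ‖w (e.1 + unitVec e.2) - w e.1‖ ^ 2 ≤
            C * (∑ e ∈ T, (‖u (e.1 + unitVec e.2) - u e.1‖ ^ 2 + ‖v (e.1 + unitVec e.2) - v e.1‖ ^ 2) +
              ((h : ℝ)⁻¹) ^ 2 * ∑ e ∈ T with (e.1 ∈ box z (ρ : ℤ) ∧ e.1 ∉ box z ((ρ : ℤ) - h - 1)), ‖u e.1 - v e.1‖ ^ 2) := by
  classical
  obtain ⟨C, hC0, hC⟩ := exists_unit_interpolant
  refine ⟨C, hC0, ?_⟩
  intro u v z ρ h hu hv h1 hhρ T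
  obtain ⟨N, hN⟩ := exists_supIndex (d := 3) z
  have hh0 : (0 : ℝ) < h := by exact_mod_cast (Nat.one_pos.trans_le h1 : 0 < h)
  -- the cutoff
  set t : Zd 3 → ℝ := fun y => min 1 (max 0 (((ρ : ℝ) - N y) / h)) with ht
  have ht0 : ∀ y, 0 ≤ t y := fun y => clamp_nonneg _
  have ht1 : ∀ y, t y ≤ 1 := fun y => clamp_le_one _
  -- `t = 0` off `Q_{ρ−1}`
  have htout : ∀ y, y ∉ box z ((ρ : ℤ) - 1) → t y = 0 := by
    intro y hy
    have hNy : ρ ≤ N y := by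
      by_contra hlt
      have : y ∈ box z ((ρ - 1 : ℕ) : ℤ) := (hN y (ρ - 1)).2 (by omega)
      have hcast : ((ρ - 1 : ℕ) : ℤ) = (ρ : ℤ) - 1 := by omega
      rw [hcast] at this; exact hy this
    refine clamp_eq_zero_of (div_nonpos_of_nonpos_of_nonneg ?_ hh0.le)
    have : (ρ : ℝ) ≤ N y := by exact_mod_cast hNy
    linarith
  -- `t = 1` on `Q_{ρ−h}`
  have htin : ∀ y ∈ box z ((ρ : ℤ) - h), t y = 1 := by
    intro y hy
    have hcast : ((ρ - h : ℕ) : ℤ) = (ρ : ℤ) - h := by omega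
    have hNy : N y ≤ ρ - h := (hN y (ρ - h)).1 (by rw [hcast]; exact hy)
    refine clamp_eq_one_of ?_
    rw [le_div_iff₀ hh0, one_mul]
    have : (N y : ℝ) + h ≤ ρ := by exact_mod_cast (by omega : N y + h ≤ ρ)
    linarith
  -- `|δt| ≤ 1∕h` along bonds, and `δt = 0` off the layer
  have hδt : ∀ (y : Zd 3) (μ : Fin 3), (t (y + unitVec μ) - t y) ^ 2 ≤ ((h : ℝ)⁻¹) ^ 2 := by
    intro y μ
    have hstep := supIndex_step hN y μ
    have habs : |t (y + unitVec μ) - t y| ≤ (h : ℝ)⁻¹ := by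
      calc |t (y + unitVec μ) - t y| ≤ |((ρ : ℝ) - N (y + unitVec μ)) / h - ((ρ : ℝ) - N y) / h| := abs_clamp_sub_clamp_le _ _
        _ = |(N y : ℝ) - N (y + unitVec μ)| / h := by
            rw [← sub_div, abs_div, abs_of_pos hh0]; congr 1; ring_nf
        _ ≤ 1 / h := by
            refine div_le_div_of_nonneg_right ?_ hh0.le
            rw [abs_le]
            constructor
            · have : (N (y + unitVec μ) : ℝ) ≤ N y + 1 := by exact_mod_cast hstep.1
              linarith
            · have : (N y : ℝ) ≤ N (y + unitVec μ) + 1 := by exact_mod_cast hstep.2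
              linarith
        _ = (h : ℝ)⁻¹ := one_div _
    calc (t (y + unitVec μ) - t y) ^ 2 = |t (y + unitVec μ) - t y| ^ 2 := (sq_abs _).symm
      _ ≤ ((h : ℝ)⁻¹) ^ 2 := pow_le_pow_left₀ (abs_nonneg _) habs 2
  have hδt0 : ∀ (y : Zd 3) (μ : Fin 3), ¬ (y ∈ box z (ρ : ℤ) ∧ y ∉ box z ((ρ : ℤ) - h - 1)) →
      (t (y + unitVec μ) - t y) ^ 2 = 0 := by
    intro y μ hy
    have hstep := supIndex_step hN y μ
    rw [not_and_or, not_not] at hy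
    rcases hy with hy | hy
    · -- source outside `Q_ρ`: both ends outside `Q_{ρ−1}`, `t = 0` at both
      have hNy : ρ + 1 ≤ N y := by
        by_contra hlt
        exact hy ((hN y ρ).2 (by omega))
      have h0a : t y = 0 := htout y fun hmem => by
        have hcast : (ρ : ℤ) - 1 = ((ρ - 1 : ℕ) : ℤ) := by omega
        rw [hcast] at hmem; have := (hN y (ρ - 1)).1 hmem; omega
      have h0b : t (y + unitVec μ) = 0 := htout _ fun hmem => by
        have hcast : (ρ : ℤ) - 1 = ((ρ - 1 : ℕ) : ℤ) := by omega
        rw [hcast] at hmem; have := (hN _ (ρ - 1)).1 hmem; omega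
      rw [h0a, h0b]; ring
    · -- source inside `Q_{ρ−h−1}`: both ends inside `Q_{ρ−h}`, `t = 1` at both
      have hρh : h + 1 ≤ ρ := by
        by_contra hlt
        have hneg : (ρ : ℤ) - h - 1 < 0 := by omega
        have : y ∉ box z ((ρ : ℤ) - h - 1) := fun hmem => by
          have h0 := (mem_box.mp hmem) 0
          linarith [abs_nonneg (y 0 - z 0)]
        exact this hy
      have hcast : (ρ : ℤ) - h - 1 = ((ρ - h - 1 : ℕ) : ℤ) := by omega
      have hNy : N y ≤ ρ - h - 1 := (hN y (ρ - h - 1)).1 (by rw [← hcast]; exact hy)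
      have h1a : t y = 1 := htin y ((hN y (ρ - h)).2 (by omega) |> fun hm => by
        have hc : ((ρ - h : ℕ) : ℤ) = (ρ : ℤ) - h := by omega
        rw [hc] at hm; exact hm)
      have h1b : t (y + unitVec μ) = 1 := htin _ ((hN _ (ρ - h)).2 (by omega) |> fun hm => by
        have hc : ((ρ - h : ℕ) : ℤ) = (ρ : ℤ) - h := by omega
        rw [hc] at hm; exact hm)
      rw [h1a, h1b]; ring
  -- B2′ at this cutoff
  obtain ⟨w, hw1, hwu, hwv, hE⟩ := hC u v t hu hv ht0 ht1 T
  refine ⟨w, hw1, fun y hy => hwu y (htout y hy), fun y hy => hwv y (htin y hy), hE.trans ?_⟩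
  -- bound the cutoff term by the layer mismatch
  have hsplit : ∑ e ∈ T, (‖u (e.1 + unitVec e.2) - u e.1‖ ^ 2 + ‖v (e.1 + unitVec e.2) - v e.1‖ ^ 2 +
        (t (e.1 + unitVec e.2) - t e.1) ^ 2 * ‖u e.1 - v e.1‖ ^ 2) =
      ∑ e ∈ T, (‖u (e.1 + unitVec e.2) - u e.1‖ ^ 2 + ‖v (e.1 + unitVec e.2) - v e.1‖ ^ 2) +
        ∑ e ∈ T, (t (e.1 + unitVec e.2) - t e.1) ^ 2 * ‖u e.1 - v e.1‖ ^ 2 := Finset.sum_add_distrib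
  have hcut : ∑ e ∈ T, (t (e.1 + unitVec e.2) - t e.1) ^ 2 * ‖u e.1 - v e.1‖ ^ 2 ≤
      ((h : ℝ)⁻¹) ^ 2 * ∑ e ∈ T with (e.1 ∈ box z (ρ : ℤ) ∧ e.1 ∉ box z ((ρ : ℤ) - h - 1)), ‖u e.1 - v e.1‖ ^ 2 := by
    rw [Finset.mul_sum, Finset.sum_filter]
    refine Finset.sum_le_sum fun e _ => ?_
    split_ifs with hlay
    · exact mul_le_mul_of_nonneg_right (hδt e.1 e.2) (by positivity)
    · rw [hδt0 e.1 e.2 hlay, zero_mul]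
  rw [hsplit, mul_add, mul_add]
  exact add_le_add le_rfl (mul_le_mul_of_nonneg_left hcut hC0)

end Summit.QuantumFields.YangMills.Theorems.PoincareLipschitzLatticeLuckhausAnnulus

end
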